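import Summits.NavierStokesRegularity.FluidComputer.RowCircuit
import HarnessLib

/-!
# The exact circuit from ANY admissible start reaches the designed end state within `Ē` (the
# one-scale transfer statement; `pub-fluidc-bp3/R1-DESIGN.md` §11.10)

HONEST FRAMING (cell `pub-fluidc`, blueprint seat bp3, gen 22): low prior, high value-of-information
experiment on Tao's machine paradigm; NOT a claim that NS blows up.

WHAT. Two read-outs of `RowChain.circuit_enclosure`, both hypothesis-free statements about the
9-mode circuit `ẏ = F gK ΛK y`:
* `circuit_enclosure_from`: the START may be any state `q₀` locked on row `0`'s lock coordinate
  (`q₀ b₁ = X0 b₁`) whose frame coordinates relative to `X0` lie in row `0`'s start box `u₀`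
  (`|A₀(q₀ − X0)| ≤ u₀`, `z0`) — the same 1066 enclosures follow (re-initialisation tolerance);
* `circuit_end_from` / `circuit_end`: with the canonical row start times `Tc k = H₀ + … + H_{k−1}`,
  the last row's tube at its end says that at the physical time `τ = s_D(Tc 1066)` the state is
  within `Ē₁₀₆₅` (coordinatewise) of the designed end state `XEND = x̂₁₀₆₅(H₁₀₆₅)` — in the data,
  `X0 ≈ (0.996, 0.088, 0, 0.002, 0.009, 0, 0, 0, 0)` (energy in the first gate's carrier `a₁`) and
  `XEND ≈ (0.003, −0.245, 0.005, 0, 0.966, 0.086, 0, 0.002, 0.009)` (energy in the second gate's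
  carrier `a₂`, the second gate's block a `0.97`-copy of the first gate's start): the one-scale
  transfer `I(n) ⇒ I(n+1)` of the paradigm, for the exact circuit. The rational numbers behind
  `XEND`, `Ē₁₀₆₅` are read out of the tables in `RowChainEnd.lean`.

[cite: Tao2016AveragedNS, §5.5 Thm 5.3 (5.5)]
-/

noncomputable section

namespace Summit.NavierStokesRegularity.FluidComputer

open Literature.Analysis.FluidPDE.FluidComputer

namespace RowChain

open RowCheck RowCheck.RowData RowRun ChainField Set

/-- **The designed end state**: row `1065`'s reference polynomial at its end. [folklore] -/
def XEND : Fin 9 → ℝ := fun a => xh (row 1065).CQ (row 1065).Hq a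

/-- **Canonical row start times**: partial sums of the certified steps. [folklore] -/
def Tc (k : ℕ) : ℝ := (Finset.range k).sum fun j => ((row j).Hq : ℝ)

/-- [folklore] -/
theorem Tc_succ (k : ℕ) : Tc (k + 1) = Tc k + (row k).Hq := by
  simp [Tc, Finset.sum_range_succ]

/-- [folklore] -/
theorem Tc_zero : Tc 0 = 0 := by
  simp [Tc]

/-- Frame coordinates of a start state relative to `X0`, in row `0`'s start frame. [folklore] -/
def z0 (q : Fin 9 → ℝ) (i : Fin 8) : ℝ := ∑ b, (canon (framesOK_row 0)).Av 0 i.succ b * (q b - X0 b)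

/-- [folklore] -/
theorem z0_X0 (i : Fin 8) : z0 X0 i = 0 := by
  simp [z0]

/-- The model's frame coordinates at the start are `z0` of the start state. [folklore] -/
theorem z_start_eq_z0 (T0 : ℝ) (y δF : ℝ → Fin 9 → ℝ) (D : Set ℝ) (s sd : ℝ → ℝ)
    {q : Fin 9 → ℝ} (hs : s T0 = 0) (hy : y 0 = q) :
    (toModel (canon (framesOK_row 0)) (G 0) T0 ⟨y, δF, D, s, sd⟩).z T0 = z0 q := by
  funext i
  show ∑ b, (canon (framesOK_row 0)).Av ((T0 - T0) / (row 0).Hq) i.succ b *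
      (y (s T0) b - xh (row 0).CQ (T0 - T0) b) = _
  rw [sub_self, zero_div, hs, hy]
  rfl

/-- **Re-initialisation tolerance**: the exact circuit from any state locked on `b₁` and within row
`0`'s start box of `X0` passes all 1066 certified enclosures (after a re-timing that exists).
[folklore] -/
theorem circuit_enclosure_from (q₀ : Fin 9 → ℝ) (hlock : q₀ (row 0).p = X0 (row 0).p)
    (hbox : ∀ i, |z0 q₀ i| ≤ (row 0).ubR 0 i)
    (T : ℕ → ℝ) (hT : ∀ k, T (k + 1) = T k + (row k).Hq) :
    ∃ y : ℝ → Fin 9 → ℝ, y 0 = q₀ ∧ (∀ σ, HasDerivAt y (F gK ΛK (y σ)) σ) ∧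
    ∃ sA sdA sB sdB sD sdD : ℝ → ℝ, sA (T 0) = 0 ∧ ∀ k < 1066,
      (∀ i, |(toModel (canon (framesOK_row k)) (G k) (T k)
        (mOf ⟨y, 0, univ, sA, sdA⟩ ⟨y, 0, univ, sB, sdB⟩ ⟨y, 0, univ, sD, sdD⟩ k)).z (T k) i| ≤
          (row k).ubR 0 i) ∧
      (∀ t ∈ Icc (T k) (T (k + 1)), ∀ a, |(toModel (canon (framesOK_row k)) (G k) (T k)
        (mOf ⟨y, 0, univ, sA, sdA⟩ ⟨y, 0, univ, sB, sdB⟩ ⟨y, 0, univ, sD, sdD⟩ k)).e t a| ≤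
          (row k).EbarR a) ∧
      (∀ t ∈ Icc (T k) (T (k + 1)), ∀ i, |(toModel (canon (framesOK_row k)) (G k) (T k)
        (mOf ⟨y, 0, univ, sA, sdA⟩ ⟨y, 0, univ, sB, sdB⟩ ⟨y, 0, univ, sD, sdD⟩ k)).z t i| ≤
          (row k).WbarR i) ∧
      (∀ t ∈ Ico (T k) (T (k + 1)),
        |(mOf ⟨y, 0, univ, sA, sdA⟩ ⟨y, 0, univ, sB, sdB⟩ ⟨y, 0, univ, sD, sdD⟩ k).sd t - 1| ≤
          (row k).rhoR) := by
  obtain ⟨y, hy0, hsol⟩ := CircuitFlow.circuit_solution gK ΛK q₀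
  have hyc : Continuous y := continuous_iff_continuousAt.2 fun σ => (hsol σ).continuousAt
  have hwin : ∀ (k k' : ℕ) (a : Fin 9), |(0 : ℝ → Fin 9 → ℝ) 0 a| ≤
      ((max ((row k).DEL a) ((row k').DEL a) : ℤ) : ℝ) / 2 ^ (row k').P :=
    fun k k' a => by
    rw [Pi.zero_apply, Pi.zero_apply, abs_zero]
    exact div_nonneg (by exact_mod_cast (DEL_nonneg_row k a).trans (le_max_left _ _))
      (by positivity)
  obtain ⟨sA, sdA, sB, sdB, sD, sdD, hs0, h⟩ := enclosure T hT (y := y) (δF := 0) (D := univ)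
    isOpen_univ
    (fun σ _ a => by simpa using (hasDerivAt_pi.1 (hsol σ)) a)
    (fun k _ => by
      have hc : Continuous fun σ => F gK ΛK (y σ) (row k).p :=
        (continuous_apply (row k).p).comp ((continuous_F gK ΛK).comp hyc)
      simpa using hc)
    (fun k _ σ _ t _ _ a => by simpa using δR_nonneg_row k a)
    (fun K _ _ => subset_univ _)
    (fun σ _ _ => ⟨subset_univ _, fun ξ _ a => hwin 656 657 a⟩)
    (fun σ _ _ => ⟨subset_univ _, fun ξ _ a => hwin 986 987 a⟩)
    (σ₀ := 0) (mem_univ _) (by rw [hy0, hlock]; rfl)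
    (fun i => by
      rw [z_start_eq_z0 (T 0) y 0 univ (fun _ => 0) (fun _ => 0) rfl hy0]
      exact hbox i)
  exact ⟨y, hy0, hsol, sA, sdA, sB, sdB, sD, sdD, hs0, h⟩

/-- **One-scale transfer, from any admissible start**: the exact circuit reaches, at some physical
time `τ` (namely `s_D(Tc 1066)`), a state within `Ē₁₀₆₅` of the designed end state `XEND`.
[folklore] -/
theorem circuit_end_from (q₀ : Fin 9 → ℝ) (hlock : q₀ (row 0).p = X0 (row 0).p)
    (hbox : ∀ i, |z0 q₀ i| ≤ (row 0).ubR 0 i) :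
    ∃ y : ℝ → Fin 9 → ℝ, y 0 = q₀ ∧ (∀ σ, HasDerivAt y (F gK ΛK (y σ)) σ) ∧
      ∃ τ : ℝ, ∀ a, |y τ a - XEND a| ≤ (row 1065).EbarR a := by
  obtain ⟨y, hy0, hsol, sA, sdA, sB, sdB, sD, sdD, -, h⟩ :=
    circuit_enclosure_from q₀ hlock hbox Tc Tc_succ
  refine ⟨y, hy0, hsol, sD (Tc 1066), fun a => ?_⟩
  obtain ⟨-, htube, -, -⟩ := h 1065 (by norm_num)
  have ht : Tc 1066 ∈ Icc (Tc 1065) (Tc (1065 + 1)) := by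
    refine ⟨?_, le_rfl⟩
    rw [show Tc 1066 = Tc 1065 + (row 1065).Hq from Tc_succ 1065]
    have hH : (0 : ℝ) < (row 1065).Hq := Hq_pos ((runOK_iff _).mp (runOK_row 1065)).1
    linarith
  have h1 := htube (Tc 1066) ht a
  rw [mOf_D (by norm_num)] at h1
  have hH : Tc 1066 - Tc 1065 = (row 1065).Hq := by
    rw [show Tc 1066 = Tc 1065 + (row 1065).Hq from Tc_succ 1065]; ring
  have he : (toModel (canon (framesOK_row 1065)) (G 1065) (Tc 1065) ⟨y, 0, univ, sD, sdD⟩).e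
      (Tc 1066) a = y (sD (Tc 1066)) a - XEND a := by
    show y (sD (Tc 1066)) a - xh (row 1065).CQ (Tc 1066 - Tc 1065) a = _
    rw [hH]
    rfl
  rw [he] at h1
  exact h1

/-- **One-scale transfer for the designed start `X0`.** [folklore] -/
theorem circuit_end : ∃ y : ℝ → Fin 9 → ℝ, y 0 = X0 ∧ (∀ σ, HasDerivAt y (F gK ΛK (y σ)) σ) ∧
    ∃ τ : ℝ, ∀ a, |y τ a - XEND a| ≤ (row 1065).EbarR a :=
  circuit_end_from X0 rfl fun i => by rw [z0_X0, abs_zero]; exact ubR_zero_nonneg_row 0 i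

end RowChain

end Summit.NavierStokesRegularity.FluidComputer
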